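/-
Origin: expansion seat `prover-pub-hodgecm-mc-sinst-1-g11-0`, handover #1260 2026-08-21T02:25Z md5 78efdffee6f6 (410 l.; NEW additive leaf; §0 ns HodgeCM.Model.SupplyResidual.WeilPairData: charInv_injective, forall_weight_of_charInv_mem_weightFunctions (charInv χ ∈ P.weightFunctions ⇒ ∀ t, χ(♯ relNormOneInfToIdeles t) · P.w t = 1); §1 ns HodgeCM.Model.ThetaDistFin (generic hermitian line ⟨d⟩, d ≠ 0): def ratDetIdele (♯ det γ for γ ∈ U(⟨d⟩)(K⁺)), ratDetIdele_mem_relNormOneRat, cmCenter_symm_ratDetIdele, finLineTorusInv_ratDetIdele (= rationalToFinAdelic γ, tree finPart_toAdelic), finLineTorusIdeles_rationalToFinAdelic (♯ det (1_∞, γ_f) = (♯(t_γ,1_f))⁻¹ · ♯ det γ, carch eq_relNormOneInfToIdeles_mul_finLineTorusIdeles), finLineTorus_/finAdelicToAdelic_rationalToFinAdelic, def ratInfPart (t_γ) / ratInfOne (u_{t_γ}) + ratInfOne_def, mk_finLineTorusIdeles_rationalToFinAdelic; §2 ns HodgeCM.Model.ThetaAdelicSide, slot 1 at splitLineOne/psiOne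 of #1254: chiOne_rationalToFinAdelic (= toUnits χ(♯(t_γ,1_f))), cWOne_eq_torusScalar_oneG_finLineTorus (cWOne = torusScalar_oneG ∘ finLineTorus), torusScalar_oneG_symm_eq_one (rational points; hη via cmEta₁_eq_one_of_rat + tree char₄_eq_one_of_rational), cWOne_rationalToFinAdelic, psiOne_rationalToFinAdelic (ψ₁(γ_f) = χ(♯(t_γ,1_f)) · torusScalar_oneG(u_{t_γ})), hasRationalRestriction_psiOne_one (hχinf) + _of_weight (w hχw hw), continuous_chiOne(_val), continuous_torusScalar_oneG_val (hηc h₁W; #1208 continuous_cmLineChar₁_of_signs), continuous_cWOne, continuous_psiOne, isLevelTrivial_psiOne (hηc h₁W, UNCONDITIONAL), isAutChar_psiOne (hη hηc h₁W hχinf), isAutChar_psiOne_of_weight; NAMES for audit: HodgeCM.Model.ThetaDistFin.finLineTorusIdeles_rationalToFinAdelic · HodgeCM.Model.ThetaAdelicSide.psiOne_rationalToFinAdelic · HodgeCM.Model.ThetaAdelicSide.isAutChar_psiOne) (`HOME/mc/pub-hodgecm-mc-sinst-1-g11/stage70/HodgeCM/Model/AdelicThetaDistributionAut.lean`, md5 78efdffee6f6,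 410 lines);
landed by the second packager p2 gen 17 (p2-g17) in gate run 70 as `HodgeCM/Model/AdelicThetaDistributionAut.lean` (verbatim).
-/
/-
Copyright (c) 2026 the pub-hodgecm formalisation cell (harness21).  New file, not vendored.
Origin: session prover-pub-hodgecm-mc-sinst-1-g11-0 (unit pub-hodgecm-mc-sinst-1-g11, S-INSTANCE CONSTRUCTOR gen 11; the AUTOMORPHY of the
slot-1 dictionary character — the socket hypothesis `hχ : (line j).IsAutChar χ″` of binder-2's #101 ∕ #102 at sinst-1's `psiOne` (#1254);
slot 0 (`charZeroDict`, #1256) in the sibling leaf `Model/AdelicThetaDistributionAutZero.lean`), 2026-08-21.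
Intended final place: `HodgeCM/Model/AdelicThetaDistributionAut.lean` (NEW additive model-layer leaf; imports sinst-1 #1256
`Model/AdelicThetaDistributionBridgeTwist`, axioms-1 #6r2 `Model/LiuDictionaryInstanceLevel` (`SplitLine.IsAutChar`), sinst-1 #1208
`Model/ArchLineSlotTypeCont` (continuity of the see-saw characters from the sign facts); imported by `Model/AdelicThetaDistributionAutZero`).
-/
import Summits.HodgeConjecture.HodgeCM.Model.AdelicThetaDistributionBridgeTwist
import Summits.HodgeConjecture.HodgeCM.Model.LiuDictionaryInstanceLevel
import Summits.HodgeConjecture.HodgeCM.Model.ArchLineSlotTypeCont_2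

set_option autoImplicit false

/-!
# The dictionary characters of the honest slots are automorphic ON THE WEIGHT SET, modulo one archimedean identity per slot (slot 1 here)

binder-2's block socket `mem_biSup_block_pin_of_mem_iSup_range` (#101 ∕ #102) wants `hχ : (line j).IsAutChar χ″`
(`IsAutChar := IsLevelTrivial ∧ HasRationalRestriction χ″ 1`, axioms-1 #6r2 — [Liu21, Def. 4.11]: the finite part of the CENTRAL character,
trivial at `∞`, cf. [Liu21, App. D Step 3] and Prop. 4.13's proof «the central character χ of π satisfies χ_∞ = 1»).  For the honest slot
characters `ψ₁ := psiOne … χ` (slot 1, #1254) and `ψ₀ := charZeroDict … χ` (slot 0, #1256) this file PROVES: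

* § 0 `charInv_injective`, `WeilPairData.forall_weight_of_charInv_mem_weightFunctions` — the weight identity `χ(♯(t,1_f)) · w t = 1` of a
  character whose `charInv` is a weight function (the `⨆_{χ, charInv χ ∈ 𝓕}` of binder-1's #R124 ∕ #R125 ranges over exactly these);
* § 1 (generic torus bookkeeping over a hermitian line `⟨d⟩`) `ratDetIdele`, `ratDetIdele_mem_relNormOneRat`,
  **`finLineTorusIdeles_rationalToFinAdelic`**: `♯ det (1_∞, γ_f) = (♯(t_γ, 1_f))⁻¹ · ♯ det γ` for a RATIONAL point `γ ∈ U(⟨d⟩)(L⁺)`,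
  `t_γ := relNormOneInfPart (♯ det γ)` (carch `eq_relNormOneInfToIdeles_mul_finLineTorusIdeles` + tree `finPart_toAdelic`) — the one place
  where `χ_∞` enters: `finLineTorusIdeles` puts `1` at the archimedean places;
* § 2 slot 1: `chiOne_rationalToFinAdelic` (`= χ(♯(t_γ,1_f))`), `cWOne_rationalToFinAdelic` (`= torusScalar_oneG(u_{t_γ})⁻¹`, by `hη` and
  [Weil1964, Thm 6] `char₄_eq_one_of_rational`), **`psiOne_rationalToFinAdelic`**: `ψ₁(γ_f) = χ(♯(t_γ,1_f)) · torusScalar_oneG(u_{t_γ})`;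
  hence **`hasRationalRestriction_psiOne_one`** under the ONE archimedean hypothesis
  `hχinf : ∀ t, χ(♯(t,1_f)) · torusScalar_oneG(u_t) = 1` — which is (`…_of_weight`) the weight identity `χ(♯(t,1_f)) · w t = 1` together with
  **(Hw₁) `w t = torusScalar_oneG(u_t)`** («the archimedean CENTRE of `U(V)` acts trivially on the slot's archimedean vector»: `harm` at central
  `u ∈ Stab x₀` + `hdef` at central `a`, carch's currency); **`isLevelTrivial_psiOne`** UNCONDITIONALLY (continuity: `hηc`, the sign facts,
  `UnitaryGroup.exists_nat_forall_dvd_finCongruenceLevel_le_ker`); **`isAutChar_psiOne`**;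
* slot 0 (the twisted record of #1256, character `charZeroDict`): the sibling leaf `Model/AdelicThetaDistributionAutZero.lean`.
So `hχ` is dischargeable for `χ` with `charInv χ ∈ 𝓕_k` from ONE archimedean identity (Hw_k) per slot and NOT otherwise (the value of `ψ_k` on a
rational point is the inverse of the archimedean central character of the slot on `t_γ`).  KERNEL only: 0 records, 0 `def … : Prop`, nothing
cited as a hypothesis; `#print axioms` ⊆ {propext, Classical.choice, Quot.sound}.
-/

noncomputable section

open MulAction IsDedekindDomain NumberField.mixedEmbedding
open NumberField hiding relNormOneIdeles relNormOneRat probHaarRelNormOneQuot relNormOneInfUnits relNormOneInfToIdeles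
open scoped Matrix TensorProduct Classical SchwartzMap
open Literature.NumberTheory.Automorphic Literature.NumberTheory.Weil1964
open Literature.NumberTheory.GelbartRogawski1991 Literature.NumberTheory.GelbartRogawski1991.UnitaryDualPair
open Literature.RepresentationTheory (SeesawScalar.twist SeesawScalar.twist_apply)
open Literature.Geometry.ComplexHyperbolic.BallModel (U21 x₀)
open Literature.AlgebraicGeometry.ShimuraVarieties
open HodgeCM.Adelic HodgeCM.PerL34 HodgeCM.Model.ArchSideTerm HodgeCM.Model.ThetaDistFin
open Literature.NumberTheory.Automorphic.UnitaryGroup (cmAdelicOneEquivRelNormOne)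

namespace HodgeCM.Model

/-! ## § 0. Weight functions: injectivity of `charInv` and the weight identity -/

namespace SupplyResidual.WeilPairData

variable {K L : Type} [Field K] [NumberField K] [Field L] [NumberField L] [Algebra K L] [FiniteDimensional K L]

omit [NumberField K] in
/-- `χ ↦ charInv χ` (`q ↦ χ(q⁻¹)`) is injective. -/
theorem charInv_injective : Function.Injective (charInv (K := K) (L := L)) := by
  intro χ χ' h
  apply ContinuousMonoidHom.ext
  intro q
  rw [← inv_inv q]
  apply Circle.coe_injective
  show charInv χ q⁻¹ = charInv χ' q⁻¹
  rw [h]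

variable {J : Type} [Fintype J] {GU : Type} [Group GU] [TopologicalSpace GU]

/-- **the weight identity of a character whose `charInv` is a weight function**: `χ(♯(t, 1_f)) · w t = 1` on the archimedean torus. -/
theorem forall_weight_of_charInv_mem_weightFunctions (P : WeilPairData K L J GU)
    {χ : PontryaginDual (↥(Literature.NumberTheory.Automorphic.relNormOneIdeles K L) ⧸
      Literature.NumberTheory.Automorphic.relNormOneRat K L)}
    (h : charInv χ ∈ P.weightFunctions) (t : ↥(Literature.NumberTheory.Automorphic.relNormOneInfUnits K L)) :
    ((χ ((Literature.NumberTheory.Automorphic.relNormOneInfToIdeles K L t :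
        ↥(Literature.NumberTheory.Automorphic.relNormOneIdeles K L)) :
          ↥(Literature.NumberTheory.Automorphic.relNormOneIdeles K L) ⧸ Literature.NumberTheory.Automorphic.relNormOneRat K L) :
        Circle) : ℂ) * P.w t = 1 := by
  obtain ⟨χ', hχ', hf⟩ := h
  rw [charInv_injective hf]
  exact hχ' t

end SupplyResidual.WeilPairData

/-! ## § 1. Rational points of a hermitian line: `♯ det (1_∞, γ_f) = (♯(t_γ, 1_f))⁻¹ · ♯ det γ` -/

namespace ThetaDistFin

section RatLine

variable (K : Type) [Field K] [NumberField K] [IsCMField K] (d : K) (hd0 : d ≠ 0)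

/-- **the norm-one idele `♯ det γ` of a rational point `γ ∈ U(⟨d⟩)(K⁺)`** (`cmAdelicDet ∘ toAdelic`, read in `ker N_{K/K⁺}(𝔸)`). -/
def ratDetIdele
    (γ : ↥(UnitaryGroup.rational (↥(maximalRealSubfield K)) K (IsCMField.complexConj K) 1 (Matrix.diagonal (lineVec K d)))) :
    ↥(Literature.NumberTheory.Automorphic.relNormOneIdeles (↥(maximalRealSubfield K)) K) :=
  cmAdelicOneEquivRelNormOne K
    (cmAdelicDet K (lineVec K d) (fun _ => hd0)
      (UnitaryGroup.toAdelic (↥(maximalRealSubfield K)) K (IsCMField.complexConj K) 1 (Matrix.diagonal (lineVec K d)) γ))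

/-- (Ported verbatim from the HodgeCMPerL package; no docstring in the source.) -/
theorem cmAdelicOneEquivRelNormOne_symm_ratDetIdele
    (γ : ↥(UnitaryGroup.rational (↥(maximalRealSubfield K)) K (IsCMField.complexConj K) 1 (Matrix.diagonal (lineVec K d)))) :
    (cmAdelicOneEquivRelNormOne K).symm (ratDetIdele K d hd0 γ) =
      cmAdelicDet K (lineVec K d) (fun _ => hd0)
        (UnitaryGroup.toAdelic (↥(maximalRealSubfield K)) K (IsCMField.complexConj K) 1 (Matrix.diagonal (lineVec K d)) γ) :=
  (cmAdelicOneEquivRelNormOne K).symm_apply_apply _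

/-- **`♯ det γ` is a RATIONAL point of the torus** (`det` of a rational point is a principal idele). -/
theorem ratDetIdele_mem_relNormOneRat
    (γ : ↥(UnitaryGroup.rational (↥(maximalRealSubfield K)) K (IsCMField.complexConj K) 1 (Matrix.diagonal (lineVec K d)))) :
    ratDetIdele K d hd0 γ ∈ Literature.NumberTheory.Automorphic.relNormOneRat (↥(maximalRealSubfield K)) K := by
  rw [Literature.NumberTheory.Automorphic.mem_relNormOneRat_iff]
  exact coe_cmAdelicDet_mem_principalIdeles K (lineVec K d) (fun _ => hd0) ⟨γ, rfl⟩

/-- the centre of the line at `♯ det γ` is the rational point itself: `(det γ) · 1₁ = γ`. -/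
theorem cmCenter_symm_ratDetIdele
    (γ : ↥(UnitaryGroup.rational (↥(maximalRealSubfield K)) K (IsCMField.complexConj K) 1 (Matrix.diagonal (lineVec K d)))) :
    CMCenter K (lineVec K d) ((cmAdelicOneEquivRelNormOne K).symm (ratDetIdele K d hd0 γ)) =
      UnitaryGroup.toAdelic (↥(maximalRealSubfield K)) K (IsCMField.complexConj K) 1 (Matrix.diagonal (lineVec K d)) γ := by
  rw [cmAdelicOneEquivRelNormOne_symm_ratDetIdele, cmCenter_cmAdelicDet_line]

/-- the finite component of `♯ det γ` read in `U(⟨d⟩)(𝔸_{K⁺,f})` is the diagonal image `γ_f`. -/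
theorem finLineTorusInv_ratDetIdele
    (γ : ↥(UnitaryGroup.rational (↥(maximalRealSubfield K)) K (IsCMField.complexConj K) 1 (Matrix.diagonal (lineVec K d)))) :
    finLineTorusInv K d (ratDetIdele K d hd0 γ) =
      UnitaryGroup.rationalToFinAdelic (↥(maximalRealSubfield K)) K (IsCMField.complexConj K) 1 (Matrix.diagonal (lineVec K d)) γ := by
  rw [finLineTorusInv_apply, cmCenter_symm_ratDetIdele, UnitaryGroup.finPart_toAdelic]

/-- **`♯ det (1_∞, γ_f) = (♯(t_γ, 1_f))⁻¹ · ♯ det γ`**, `t_γ := relNormOneInfPart (♯ det γ)`: the finite torus embedding of a rational point differs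
from the (rational) diagonal idele by the archimedean factor. -/
theorem finLineTorusIdeles_rationalToFinAdelic
    (γ : ↥(UnitaryGroup.rational (↥(maximalRealSubfield K)) K (IsCMField.complexConj K) 1 (Matrix.diagonal (lineVec K d)))) :
    finLineTorusIdeles K d hd0
        (UnitaryGroup.rationalToFinAdelic (↥(maximalRealSubfield K)) K (IsCMField.complexConj K) 1 (Matrix.diagonal (lineVec K d)) γ) =
      (Literature.NumberTheory.Automorphic.relNormOneInfToIdeles (↥(maximalRealSubfield K)) K
          (Literature.NumberTheory.Automorphic.relNormOneInfPart K (↥(maximalRealSubfield K)) (ratDetIdele K d hd0 γ)))⁻¹ *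
        ratDetIdele K d hd0 γ := by
  rw [eq_inv_mul_iff_mul_eq, ← finLineTorusInv_ratDetIdele K d hd0 γ]
  exact (eq_relNormOneInfToIdeles_mul_finLineTorusIdeles K d hd0 (ratDetIdele K d hd0 γ)).symm

/-- the same in `U(1)(𝔸_{K⁺})` currency: `det (1_∞, γ_f) = u_{t_γ}⁻¹ · det γ`. -/
theorem finLineTorus_rationalToFinAdelic
    (γ : ↥(UnitaryGroup.rational (↥(maximalRealSubfield K)) K (IsCMField.complexConj K) 1 (Matrix.diagonal (lineVec K d)))) :
    finLineTorus K d hd0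
        (UnitaryGroup.rationalToFinAdelic (↥(maximalRealSubfield K)) K (IsCMField.complexConj K) 1 (Matrix.diagonal (lineVec K d)) γ) =
      ((cmAdelicOneEquivRelNormOne K).symm
          (Literature.NumberTheory.Automorphic.relNormOneInfToIdeles (↥(maximalRealSubfield K)) K
            (Literature.NumberTheory.Automorphic.relNormOneInfPart K (↥(maximalRealSubfield K)) (ratDetIdele K d hd0 γ))))⁻¹ *
        (cmAdelicOneEquivRelNormOne K).symm (ratDetIdele K d hd0 γ) := by
  rw [← cmAdelicOneEquivRelNormOne_symm_finLineTorusIdeles, finLineTorusIdeles_rationalToFinAdelic, map_mul, map_inv]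

/-- and in `U(⟨d⟩)(𝔸_{K⁺})` currency: `(1_∞, γ_f) = ((t_γ, 1_f) · 1₁)⁻¹ · γ`. -/
theorem finAdelicToAdelic_rationalToFinAdelic
    (γ : ↥(UnitaryGroup.rational (↥(maximalRealSubfield K)) K (IsCMField.complexConj K) 1 (Matrix.diagonal (lineVec K d)))) :
    UnitaryGroup.finAdelicToAdelic (↥(maximalRealSubfield K)) K (IsCMField.complexConj K) 1 (Matrix.diagonal (lineVec K d))
        (UnitaryGroup.rationalToFinAdelic (↥(maximalRealSubfield K)) K (IsCMField.complexConj K) 1 (Matrix.diagonal (lineVec K d)) γ) =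
      (CMCenter K (lineVec K d)
          ((cmAdelicOneEquivRelNormOne K).symm
            (Literature.NumberTheory.Automorphic.relNormOneInfToIdeles (↥(maximalRealSubfield K)) K
              (Literature.NumberTheory.Automorphic.relNormOneInfPart K (↥(maximalRealSubfield K)) (ratDetIdele K d hd0 γ)))))⁻¹ *
        UnitaryGroup.toAdelic (↥(maximalRealSubfield K)) K (IsCMField.complexConj K) 1 (Matrix.diagonal (lineVec K d)) γ := by
  rw [← cmCenter_finLineTorus K d hd0, finLineTorus_rationalToFinAdelic, map_mul, map_inv, cmCenter_symm_ratDetIdele]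


/-- **`t_γ`**: the archimedean component of `♯ det γ`, an element of the archimedean torus `T_∞ = U(1)(K⁺ ⊗ ℝ)`. -/
def ratInfPart
    (γ : ↥(UnitaryGroup.rational (↥(maximalRealSubfield K)) K (IsCMField.complexConj K) 1 (Matrix.diagonal (lineVec K d)))) :
    ↥(Literature.NumberTheory.Automorphic.relNormOneInfUnits (↥(maximalRealSubfield K)) K) :=
  Literature.NumberTheory.Automorphic.relNormOneInfPart K (↥(maximalRealSubfield K)) (ratDetIdele K d hd0 γ)

/-- `u_{t_γ}`: the same read in `U(1)(𝔸_{K⁺})` (`(t_γ, 1_f)`). -/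
def ratInfOne
    (γ : ↥(UnitaryGroup.rational (↥(maximalRealSubfield K)) K (IsCMField.complexConj K) 1 (Matrix.diagonal (lineVec K d)))) :
    CMAdelicOne K :=
  (cmAdelicOneEquivRelNormOne K).symm
    (Literature.NumberTheory.Automorphic.relNormOneInfToIdeles (↥(maximalRealSubfield K)) K (ratInfPart K d hd0 γ))

/-- (Ported verbatim from the HodgeCMPerL package; no docstring in the source.) -/
theorem ratInfOne_def
    (γ : ↥(UnitaryGroup.rational (↥(maximalRealSubfield K)) K (IsCMField.complexConj K) 1 (Matrix.diagonal (lineVec K d)))) :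
    ratInfOne K d hd0 γ = (cmAdelicOneEquivRelNormOne K).symm
      (Literature.NumberTheory.Automorphic.relNormOneInfToIdeles (↥(maximalRealSubfield K)) K (ratInfPart K d hd0 γ)) := rfl

/-- in the quotient `ker N(𝔸) ∕ ker N(K⁺-points)`: **`♯ det (1_∞, γ_f) ≡ (♯(t_γ, 1_f))⁻¹`**. -/
theorem mk_finLineTorusIdeles_rationalToFinAdelic
    (γ : ↥(UnitaryGroup.rational (↥(maximalRealSubfield K)) K (IsCMField.complexConj K) 1 (Matrix.diagonal (lineVec K d)))) :
    (QuotientGroup.mk (s := Literature.NumberTheory.Automorphic.relNormOneRat (↥(maximalRealSubfield K)) K)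
        (finLineTorusIdeles K d hd0
          (UnitaryGroup.rationalToFinAdelic (↥(maximalRealSubfield K)) K (IsCMField.complexConj K) 1 (Matrix.diagonal (lineVec K d)) γ)) :
        ↥(Literature.NumberTheory.Automorphic.relNormOneIdeles (↥(maximalRealSubfield K)) K) ⧸
          Literature.NumberTheory.Automorphic.relNormOneRat (↥(maximalRealSubfield K)) K) =
      (QuotientGroup.mk (Literature.NumberTheory.Automorphic.relNormOneInfToIdeles (↥(maximalRealSubfield K)) K (ratInfPart K d hd0 γ)) :
        ↥(Literature.NumberTheory.Automorphic.relNormOneIdeles (↥(maximalRealSubfield K)) K) ⧸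
          Literature.NumberTheory.Automorphic.relNormOneRat (↥(maximalRealSubfield K)) K)⁻¹ := by
  rw [finLineTorusIdeles_rationalToFinAdelic, QuotientGroup.mk_mul_of_mem _ (ratDetIdele_mem_relNormOneRat K d hd0 γ),
    QuotientGroup.mk_inv]
  rfl

end RatLine

end ThetaDistFin

/-! ## § 2. Slot 1: `ψ₁ = psiOne χ` -/


namespace ThetaAdelicSide

variable {L : CMField} {ι₁ : L →+* ℂ} (V : HermSpace3 L ι₁) (c : SeesawCtx L)
  (hGR : (cmSplittingDatum (L : Type) finProdFinEquiv (frameD V) (frameD_real V) (frameD_ne V) (dW c.D) (dW_real c.D)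
    (dW_ne c.D)).CompatibleSplitting)
  (hGR₀ : (cmSplittingDatum (L : Type) (e₁) (frameD V) (frameD_real V) (frameD_ne V) (lineVec (L : Type) (dW c.D 0))
    (fun _ => dW_real c.D 0) (fun _ => dW_ne c.D 0)).CompatibleSplitting)
  (hGR₁ : (cmSplittingDatum (L : Type) (e₁) (frameD V) (frameD_real V) (frameD_ne V) (lineVec (L : Type) (dW c.D 1))
    (fun _ => dW_real c.D 1) (fun _ => dW_ne c.D 1)).CompatibleSplitting)
  (η : CMAdelic (L : Type) (frameD V) × CMAdelic (L : Type) (dW c.D) →* ℂˣ)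
  (hη : ∀ γU ∈ CMRat (L : Type) (frameD V), ∀ γ ∈ CMRat (L : Type) (dW c.D), η (γU, γ) = 1)
  (hηc : Continuous fun p => ((η p : ℂˣ) : ℂ))
  (h₁W : (∀ j, 0 < (ι₁ (dW c.D j)).re) ∨ ∀ j, (ι₁ (dW c.D j)).re < 0)
  (χ : PontryaginDual (↥(relNormOneIdeles (↥(maximalRealSubfield L)) L) ⧸ relNormOneRat (↥(maximalRealSubfield L)) L))

/-! ### § 2a. The values of `chiOne`, `cWOne`, `psiOne` on rational points -/

/-- **`chiOne χ (γ_f) = χ(♯(t_γ, 1_f))`** — on a rational point the coinvariant character of slot 1 reads the ARCHIMEDEAN component of `χ`. -/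
theorem chiOne_rationalToFinAdelic
    (γ : ↥(UnitaryGroup.rational (↥(maximalRealSubfield L)) (L : Type) (IsCMField.complexConj L) 1
      (Matrix.diagonal (lineVec (L : Type) (dW c.D 1))))) :
    chiOne c χ (UnitaryGroup.rationalToFinAdelic (↥(maximalRealSubfield L)) (L : Type) (IsCMField.complexConj L) 1
        (Matrix.diagonal (lineVec (L : Type) (dW c.D 1))) γ) =
      Circle.toUnits (χ (QuotientGroup.mk
        (relNormOneInfToIdeles (↥(maximalRealSubfield L)) L (ratInfPart (L : Type) (dW c.D 1) (dW_ne c.D 1) γ)))) := by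
  rw [chiOne]
  simp only [MonoidHom.coe_comp, Function.comp_apply, QuotientGroup.mk'_apply, invMonoidHom_apply,
    mk_finLineTorusIdeles_rationalToFinAdelic, map_inv, inv_inv, MonoidHom.coe_coe]

/-- **`cWOne = torusScalar_oneG ∘ finLineTorus`**: the W-part of the slot-1 see-saw character IS carch's torus scalar of line 1 read at
`det (1_∞, u_f)` (`cmCenter_finLineTorus`). -/
theorem cWOne_eq_torusScalar_oneG_finLineTorus (u : UfOne c.D) :
    cWOne V c hGR hGR₀ hGR₁ η u =
      torusScalar_oneG V c.D hGR hGR₀ hGR₁ (eta₁ V c.D η) (finLineTorus (L : Type) (dW c.D 1) (dW_ne c.D 1) u) := by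
  rw [cWOne_apply, finCharOne_apply, finPairDOne_apply, map_one, map_one, torusScalar_one_applyG, cmCenter_finLineTorus]
  rfl

include hη in
/-- **the torus scalar of line 1 is trivial on RATIONAL points** (`η₁` by the W pin's `hη` through `cmEta₁_eq_one_of_rat`; `χ₁ = λ₄` by
[Weil1964, Thm 6] through the tree's `char₄_eq_one_of_rational`). -/
theorem torusScalar_oneG_symm_eq_one {t₀ : ↥(relNormOneIdeles (↥(maximalRealSubfield L)) L)}
    (ht₀ : t₀ ∈ relNormOneRat (↥(maximalRealSubfield L)) L) :
    torusScalar_oneG V c.D hGR hGR₀ hGR₁ (eta₁ V c.D η) ((cmAdelicOneEquivRelNormOne (L : Type)).symm t₀) = 1 := by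
  have hη1 : eta₁ V c.D η (1, (cmAdelicOneEquivRelNormOne (L : Type)).symm t₀) = 1 :=
    cmEta₁_eq_one_of_rat (L : Type) (frameD V) (dW c.D) η hη ht₀
  obtain ⟨γ₀, hγ₀⟩ := UnitaryGroup.cm_adelicCenter_symm_mem_range_toAdelic (L : Type) 1
    (Matrix.diagonal (lineVec (L : Type) (dW c.D 1))) t₀ ht₀
  have hχ1 : cmLineChar₁ (L : Type) finProdFinEquiv e₁ (frameD V) (frameD_real V) (frameD_ne V) (dW c.D) (dW_real c.D) (dW_ne c.D)
      hGR hGR₀ hGR₁ (1, CMCenter (L : Type) (lineVec (L : Type) (dW c.D 1)) ((cmAdelicOneEquivRelNormOne (L : Type)).symm t₀)) = 1 := by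
    rw [cmLineChar₁]
    simp only [MonoidHom.coe_comp, Function.comp_apply, MonoidHom.coe_snd]
    apply char₄_eq_one_of_rational
    · exact ratIsometry_one_lineVec (L : Type) (dW c.D)
    · exact ⟨γ₀, hγ₀⟩
  rw [torusScalar_one_applyG, hη1, hχ1, mul_one]

include hη in
/-- **`cWOne (γ_f) = torusScalar_oneG(u_{t_γ})⁻¹`** — on a rational point only the inverse of the archimedean value of the torus scalar
remains. -/
theorem cWOne_rationalToFinAdelic
    (γ : ↥(UnitaryGroup.rational (↥(maximalRealSubfield L)) (L : Type) (IsCMField.complexConj L) 1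
      (Matrix.diagonal (lineVec (L : Type) (dW c.D 1))))) :
    cWOne V c hGR hGR₀ hGR₁ η (UnitaryGroup.rationalToFinAdelic (↥(maximalRealSubfield L)) (L : Type) (IsCMField.complexConj L) 1
        (Matrix.diagonal (lineVec (L : Type) (dW c.D 1))) γ) =
      (torusScalar_oneG V c.D hGR hGR₀ hGR₁ (eta₁ V c.D η) (ratInfOne (L : Type) (dW c.D 1) (dW_ne c.D 1) γ))⁻¹ := by
  rw [cWOne_eq_torusScalar_oneG_finLineTorus, finLineTorus_rationalToFinAdelic, map_mul, map_inv,
    torusScalar_oneG_symm_eq_one V c hGR hGR₀ hGR₁ η hη (ratDetIdele_mem_relNormOneRat (L : Type) (dW c.D 1) (dW_ne c.D 1) γ),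
    mul_one]
  rfl

include hη in
/-- **`ψ₁(γ_f) = χ(♯(t_γ, 1_f)) · torusScalar_oneG(u_{t_γ})`**: the value of the slot-1 dictionary character on a rational point is an
ARCHIMEDEAN quantity — the archimedean component of `χ` times the archimedean value of the slot's torus scalar. -/
theorem psiOne_rationalToFinAdelic
    (γ : ↥(UnitaryGroup.rational (↥(maximalRealSubfield L)) (L : Type) (IsCMField.complexConj L) 1
      (Matrix.diagonal (lineVec (L : Type) (dW c.D 1))))) :
    psiOne V c hGR hGR₀ hGR₁ η χ (UnitaryGroup.rationalToFinAdelic (↥(maximalRealSubfield L)) (L : Type) (IsCMField.complexConj L) 1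
        (Matrix.diagonal (lineVec (L : Type) (dW c.D 1))) γ) =
      Circle.toUnits (χ (QuotientGroup.mk
          (relNormOneInfToIdeles (↥(maximalRealSubfield L)) L (ratInfPart (L : Type) (dW c.D 1) (dW_ne c.D 1) γ)))) *
        torusScalar_oneG V c.D hGR hGR₀ hGR₁ (eta₁ V c.D η) (ratInfOne (L : Type) (dW c.D 1) (dW_ne c.D 1) γ) := by
  rw [psiOne, MonoidHom.mul_apply, MonoidHom.inv_apply, chiOne_rationalToFinAdelic, cWOne_rationalToFinAdelic V c hGR hGR₀ hGR₁ η hη,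
    inv_inv]

/-! ### § 2b. Rational triviality from ONE archimedean identity -/

include hη in
/-- **`ψ₁` IS TRIVIAL ON `U(⟨a₁⟩)(L⁺)`** as soon as `χ(♯(t, 1_f)) · torusScalar_oneG(u_t) = 1` on the archimedean torus — for `χ` on the
slot's weight set this is the ONE archimedean identity (Hw₁) `w₁ t = torusScalar_oneG(u_t)` («the archimedean centre of `U(V)` acts
trivially on the slot's archimedean vector»), see `hasRationalRestriction_psiOne_one_of_weight`. -/
theorem hasRationalRestriction_psiOne_one
    (hχinf : ∀ t : ↥(relNormOneInfUnits (↥(maximalRealSubfield L)) L),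
      ((χ (QuotientGroup.mk (relNormOneInfToIdeles (↥(maximalRealSubfield L)) L t)) : Circle) : ℂ) *
          ((torusScalar_oneG V c.D hGR hGR₀ hGR₁ (eta₁ V c.D η)
            ((cmAdelicOneEquivRelNormOne (L : Type)).symm (relNormOneInfToIdeles (↥(maximalRealSubfield L)) L t)) : ℂˣ) : ℂ) = 1) :
    (splitLineOne V c hGR₁).HasRationalRestriction (psiOne V c hGR hGR₀ hGR₁ η χ) 1 := by
  rw [SplitLine.hasRationalRestriction_iff]
  intro γ
  apply Units.ext
  have h := congrArg Units.val (psiOne_rationalToFinAdelic V c hGR hGR₀ hGR₁ η hη χ γ)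
  rw [Units.val_mul] at h
  rw [MonoidHom.one_apply, Units.val_one]
  exact h.trans (hχinf _)

include hη in
/-- the same from the WEIGHT identity of `χ` (`charInv χ` a weight function for the weight `w`) and (Hw₁) `w t = torusScalar_oneG(u_t)`. -/
theorem hasRationalRestriction_psiOne_one_of_weight (w : ↥(relNormOneInfUnits (↥(maximalRealSubfield L)) L) → ℂ)
    (hχw : ∀ t : ↥(relNormOneInfUnits (↥(maximalRealSubfield L)) L),
      ((χ (QuotientGroup.mk (relNormOneInfToIdeles (↥(maximalRealSubfield L)) L t)) : Circle) : ℂ) * w t = 1)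
    (hw : ∀ t : ↥(relNormOneInfUnits (↥(maximalRealSubfield L)) L),
      w t = ((torusScalar_oneG V c.D hGR hGR₀ hGR₁ (eta₁ V c.D η)
        ((cmAdelicOneEquivRelNormOne (L : Type)).symm (relNormOneInfToIdeles (↥(maximalRealSubfield L)) L t)) : ℂˣ) : ℂ)) :
    (splitLineOne V c hGR₁).HasRationalRestriction (psiOne V c hGR hGR₀ hGR₁ η χ) 1 :=
  hasRationalRestriction_psiOne_one V c hGR hGR₀ hGR₁ η hη χ fun t => by rw [← hw t]; exact hχw t

/-! ### § 2c. Level triviality (continuity) and `IsAutChar` -/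

/-- the coinvariant character of slot 1 has continuous values. -/
theorem continuous_chiOne_val : Continuous fun u : UfOne c.D => ((chiOne c χ u : ℂˣ) : ℂ) := by
  have hf : Continuous (finLineTorusIdeles (L : Type) (dW c.D 1) (dW_ne c.D 1)) :=
    (continuous_cmAdelicOneEquivRelNormOne (L : Type)).comp
      ((continuous_cmAdelicDet (L : Type) (lineVec (L : Type) (dW c.D 1)) fun _ => dW_ne c.D 1).comp
        (UnitaryGroup.continuous_finAdelicToAdelic _ _ _ _ _))
  show Continuous fun u : UfOne c.D =>
    ((((χ : ↥(relNormOneIdeles (↥(maximalRealSubfield L)) L) ⧸ relNormOneRat (↥(maximalRealSubfield L)) L →* Circle)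
      (QuotientGroup.mk (finLineTorusIdeles (L : Type) (dW c.D 1) (dW_ne c.D 1) u)))⁻¹ : Circle) : ℂ)
  exact continuous_subtype_val.comp (((map_continuous χ).comp (QuotientGroup.continuous_mk.comp hf)).inv)

/-- the coinvariant character of slot 1 is continuous (into `ℂˣ`). -/
theorem continuous_chiOne : Continuous (chiOne c χ) :=
  (chiOne c χ).continuous_of_continuous_units_val (continuous_chiOne_val c χ)

include hηc h₁W in
/-- carch's torus scalar of line 1 has continuous values (the W pin's `hηc`; `χ₁ = λ₄` continuous from the sign facts of `V` and of the plane
at `ι₁`, sinst-1 #1208 `continuous_cmLineChar₁_of_signs`). -/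
theorem continuous_torusScalar_oneG_val :
    Continuous fun u : CMAdelicOne (L : Type) => ((torusScalar_oneG V c.D hGR hGR₀ hGR₁ (eta₁ V c.D η) u : ℂˣ) : ℂ) := by
  have h1 : Continuous fun u : CMAdelicOne (L : Type) => ((eta₁ V c.D η (1, u) : ℂˣ) : ℂ) :=
    (continuous_cmEta₁_comp_snd (L : Type) (frameD V) (dW c.D) η hηc).comp (continuous_const.prodMk continuous_id)
  have h2 : Continuous fun u : CMAdelicOne (L : Type) =>
      ((cmLineChar₁ (L : Type) finProdFinEquiv e₁ (frameD V) (frameD_real V) (frameD_ne V) (dW c.D) (dW_real c.D) (dW_ne c.D) hGR hGR₀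
        hGR₁ (1, CMCenter (L : Type) (lineVec (L : Type) (dW c.D 1)) u) : ℂˣ) : ℂ) :=
    (continuous_cmLineChar₁_of_signs (L : Type) finProdFinEquiv e₁ (frameD V) (frameD_real V) (frameD_ne V) (dW c.D) (dW_real c.D)
        (dW_ne c.D) hGR hGR₀ hGR₁ ι₁ (frameD_sign_ι₁' V) h₁W (frameD_sign_of_ne V)).comp
      (continuous_const.prodMk (continuous_adelicCenter _ _ _ _ _))
  simp only [torusScalar_one_applyG, Units.val_mul]
  exact h1.mul h2

include hηc h₁W in
/-- `cWOne` is continuous (into `ℂˣ`). -/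
theorem continuous_cWOne : Continuous (cWOne V c hGR hGR₀ hGR₁ η) := by
  apply (cWOne V c hGR hGR₀ hGR₁ η).continuous_of_continuous_units_val
  have hf : Continuous (finLineTorus (L : Type) (dW c.D 1) (dW_ne c.D 1)) :=
    (continuous_cmAdelicDet (L : Type) (lineVec (L : Type) (dW c.D 1)) fun _ => dW_ne c.D 1).comp
      (UnitaryGroup.continuous_finAdelicToAdelic _ _ _ _ _)
  simp only [cWOne_eq_torusScalar_oneG_finLineTorus]
  exact (continuous_torusScalar_oneG_val V c hGR hGR₀ hGR₁ η hηc h₁W).comp hf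

include hηc h₁W in
/-- `ψ₁` is continuous (into `ℂˣ`). -/
theorem continuous_psiOne : Continuous (psiOne V c hGR hGR₀ hGR₁ η χ) := by
  show Continuous fun u => chiOne c χ u * (cWOne V c hGR hGR₀ hGR₁ η u)⁻¹
  exact (continuous_chiOne c χ).mul (continuous_cWOne V c hGR hGR₀ hGR₁ η hηc h₁W).inv

include hηc h₁W in
/-- **`ψ₁` IS LEVEL-TRIVIAL** — unconditionally (continuity + `UnitaryGroup.exists_nat_forall_dvd_finCongruenceLevel_le_ker`). -/
theorem isLevelTrivial_psiOne : (splitLineOne V c hGR₁).IsLevelTrivial (psiOne V c hGR hGR₀ hGR₁ η χ) := by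
  obtain ⟨n₀, hn₀, h⟩ := UnitaryGroup.exists_nat_forall_dvd_finCongruenceLevel_le_ker (psiOne V c hGR hGR₀ hGR₁ η χ)
    (continuous_psiOne V c hGR hGR₀ hGR₁ η hηc h₁W χ).continuousAt
  exact ⟨n₀, hn₀, fun k hk => h n₀ hn₀ (dvd_refl _) k hk⟩


-- port_pkg: scope closed for this part
end ThetaAdelicSide
end HodgeCM.Model
end
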